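import Mathlib.Analysis.Fourier.FiniteAbelian.PontryaginDuality
import Mathlib.Analysis.RCLike.Basic
import Mathlib.RingTheory.IntegralClosure.IntegrallyClosed
import Mathlib.RingTheory.IntegralClosure.IsIntegralClosure.Basic
import Mathlib.Algebra.GroupWithZero.Units.Equiv
import Mathlib.Data.ZMod.Basic
import Mathlib.Algebra.Field.ZMod
import Mathlib.GroupTheory.OrderOfElement
import HarnessLib

/-!
# Characters of an elementary abelian `p`-group: roots of unity, Galois averaging, Fourier inversion

ω-census `pub-omega`, family (b3), seat pub-omega-group gen 30.  Framing: lottery ticket; floor = certified bounds/negative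
ranges.  VALUE: the character-theoretic toolkit for the NORM CONGRUENCE of domino cube law triples
(`DominoNormCongruence.lean`, namespace `DominoNorm`: `|B| ∣ (3d²)^{p−1} − 1` for every quotient `B` of exponent `p ≥ 5`); NOT progress on ω.

Contents (all elementary; `B` a finite abelian group with `p • b = 0` for all `b`, `p` prime):
* `pow_mod_eq_of_pow_eq_one`, `pow_val_mul`: exponent bookkeeping for `p`-th roots of unity indexed by `ZMod p`;
* `sum_pow_val`: `∑_{l : ZMod p} ζ^{l} = p·[ζ = 1]` for `ζ^p = 1`;
* `prod_pow_val_eq_one`: `∏_{j : ZMod p} ξ^{j} = 1` for `ξ^p = 1`, `p` odd;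
* `prod_pow_add_pow_sub_one_eq_one`: **`∏_{j : ZMod p} (θ^j + θ^{−j} − 1) = 1`** for `θ^p = 1`, `p ≥ 5` — the identity
  `(θ^j + 1)(θ^j + θ^{−j} − 1) = θ^{−j}(θ^{3j} + 1)` and the reindexing `j ↦ 3j`;
* `addChar_pow_p`, `addChar_pow_ne_zero`: characters of `B` have order `p`;
* `prod_erase_zero_nonneg`: a product over `j ≠ 0` of values with `f(−j) = conj (f j)` is a nonnegative real;
* `card_mul_eq_sum_charsum`, `card_dvd_of_charsum_const`: Fourier inversion — if an INTEGER-valued function on `B` has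
  character sums equal to one constant `c` at every non-trivial character, then `|B| ∣ (Σ E) − c`;
* `isIntegral_addChar_apply`, `exists_int_of_isIntegral_of_eq_rat`: a rational algebraic integer is an integer.
-/

namespace Summit.MatrixMultiplication.OmegaCensus.DominoNorm

open Finset

/-! ## Roots of unity indexed by `ZMod p` -/

section RootsOfUnity

variable {p : ℕ}

/-- `ζ ^ (n % p) = ζ ^ n` when `ζ ^ p = 1`. [folklore] -/
theorem pow_mod_eq_of_pow_eq_one {M : Type*} [Monoid M] {ζ : M} (hζ : ζ ^ p = 1) (n : ℕ) :
    ζ ^ (n % p) = ζ ^ n := by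
  conv_rhs => rw [← Nat.mod_add_div n p, pow_add, pow_mul, hζ, one_pow, mul_one]

/-- `ζ ^ (l * j).val = (ζ ^ l.val) ^ j.val` when `ζ ^ p = 1`. [folklore] -/
theorem pow_val_mul {M : Type*} [Monoid M] {ζ : M} (hζ : ζ ^ p = 1) (l j : ZMod p) :
    ζ ^ (l * j).val = (ζ ^ l.val) ^ j.val := by
  rw [ZMod.val_mul, pow_mod_eq_of_pow_eq_one hζ, pow_mul]

/-- `ζ ^ (-j).val * ζ ^ j.val = 1` when `ζ ^ p = 1`. [folklore] -/
theorem pow_val_neg_mul_pow_val [NeZero p] {M : Type*} [Monoid M] {ζ : M} (hζ : ζ ^ p = 1) (j : ZMod p) :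
    ζ ^ (-j).val * ζ ^ j.val = 1 := by
  rw [← pow_add, ZMod.neg_val]
  split_ifs with hj
  · rw [hj, ZMod.val_zero, pow_zero]
  · rw [Nat.sub_add_cancel (ZMod.val_lt j).le, hζ]

/-- In `ZMod p`, `p` an odd prime, `-j = j` forces `j = 0`. [folklore] -/
theorem eq_zero_of_neg_eq_self [hp : Fact p.Prime] (hp2 : p ≠ 2) {j : ZMod p} (h : -j = j) : j = 0 := by
  have h2 : (2 : ZMod p) ≠ 0 := by
    intro h0
    have : ((2 : ℕ) : ZMod p) = 0 := by exact_mod_cast h0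
    rw [ZMod.natCast_eq_zero_iff] at this
    exact hp2 ((Nat.prime_dvd_prime_iff_eq hp.out Nat.prime_two).1 this)
  have h' : (2 : ZMod p) * j = 0 := by rw [two_mul]; nth_rewrite 1 [← h]; rw [neg_add_cancel]
  rcases mul_eq_zero.1 h' with h'' | h''
  · exact absurd h'' h2
  · exact h''

/-- **Geometric sum over `ZMod p`.** For `ζ ^ p = 1`: `∑_{l : ZMod p} ζ^{l.val} = p` if `ζ = 1`, else `0`. [folklore] -/
theorem sum_pow_val [hp : Fact p.Prime] {ζ : ℂ} (hζ : ζ ^ p = 1) :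
    ∑ l : ZMod p, ζ ^ l.val = if ζ = 1 then (p : ℂ) else 0 := by
  split_ifs with h1
  · simp [h1]
  · have key : ζ * ∑ l : ZMod p, ζ ^ l.val = ∑ l : ZMod p, ζ ^ l.val := by
      rw [Finset.mul_sum]
      have e : ∀ l : ZMod p, ζ * ζ ^ l.val = ζ ^ (l + 1).val := by
        intro l
        rw [ZMod.val_add, pow_mod_eq_of_pow_eq_one hζ, pow_add, ZMod.val_one, pow_one, mul_comm]
      simp_rw [e]
      exact Fintype.sum_equiv (Equiv.addRight 1) _ _ (fun l => rfl)
    have h0 : (ζ - 1) * ∑ l : ZMod p, ζ ^ l.val = 0 := by rw [sub_mul, one_mul, key, sub_self]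
    exact (mul_eq_zero.1 h0).resolve_left (sub_ne_zero.2 h1)

/-- For `ξ ^ p = 1`, `p` an odd prime: `∏_{j : ZMod p} ξ^{j.val} = 1` (pair `j` with `−j`). [folklore] -/
theorem prod_pow_val_eq_one [hp : Fact p.Prime] (hp2 : p ≠ 2) {ξ : ℂ} (hξ : ξ ^ p = 1) : ∏ j : ZMod p, ξ ^ j.val = 1 := by
  refine Finset.prod_ninvolution (fun j => -j) ?_ ?_ (fun _ => mem_univ _) (fun j => neg_neg j)
  · intro j
    rw [mul_comm]
    exact pow_val_neg_mul_pow_val hξ j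
  · intro j hj h
    apply hj
    rw [eq_zero_of_neg_eq_self hp2 h, ZMod.val_zero, pow_zero]

/-- `θ ^ j.val + 1 ≠ 0` for a `p`-th root of unity `θ`, `p` odd. [folklore] -/
theorem pow_val_add_one_ne_zero [hp : Fact p.Prime] (hp2 : p ≠ 2) {θ : ℂ} (hθ : θ ^ p = 1) (j : ZMod p) : θ ^ j.val + 1 ≠ 0 := by
  intro h
  have hx : θ ^ j.val = -1 := eq_neg_of_add_eq_zero_left h
  have h1 : (θ ^ j.val) ^ p = 1 := by rw [← pow_mul, mul_comm, pow_mul, hθ, one_pow]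
  rw [hx, (hp.out.odd_of_ne_two hp2).neg_one_pow] at h1
  norm_num at h1

/-- **Product identity.** For `θ ^ p = 1`, `θ θ' = 1`, `p ≥ 5` prime:
`∏_{j : ZMod p} (θ^{j} + θ'^{j} − 1) = 1`.  Proof: `(θ^j + 1)(θ^j + θ'^j − 1) = θ'^j (θ^{3j} + 1)`, the products of
`θ'^j` and the reindexing `j ↦ 3j`. [folklore] -/
theorem prod_pow_add_pow_sub_one_eq_one [hp : Fact p.Prime] (hp5 : 5 ≤ p) {θ θ' : ℂ} (hθ : θ ^ p = 1)
    (hθθ' : θ * θ' = 1) :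
    ∏ j : ZMod p, (θ ^ j.val + θ' ^ j.val - 1) = 1 := by
  have hp2 : p ≠ 2 := by omega
  have hθ' : θ' ^ p = 1 := by
    have h := congrArg (· ^ p) hθθ'
    simp only [mul_pow, hθ, one_mul, one_pow] at h
    exact h
  have h3val : (3 : ZMod p).val = 3 := by
    rw [show (3 : ZMod p) = ((3 : ℕ) : ZMod p) by norm_cast, ZMod.val_natCast]
    exact Nat.mod_eq_of_lt (by omega)
  have h3ne : (3 : ZMod p) ≠ 0 := by
    intro h; rw [← ZMod.val_eq_zero, h3val] at h; norm_num at h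
  -- the per-factor identity
  have hfac : ∀ j : ZMod p,
      (θ ^ j.val + 1) * (θ ^ j.val + θ' ^ j.val - 1) = θ' ^ j.val * (θ ^ (3 * j).val + 1) := by
    intro j
    have e3 : θ ^ (3 * j).val = (θ ^ j.val) ^ 3 := by
      rw [ZMod.val_mul, pow_mod_eq_of_pow_eq_one hθ, h3val, pow_mul']
    have hu : θ ^ j.val * θ' ^ j.val = 1 := by rw [← mul_pow, hθθ', one_pow]
    rw [e3]
    linear_combination (-((θ ^ j.val) ^ 2 - 1)) * hu
  have hP : (∏ j : ZMod p, (θ ^ j.val + 1)) * ∏ j : ZMod p, (θ ^ j.val + θ' ^ j.val - 1) =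
      (∏ j : ZMod p, θ' ^ j.val) * ∏ j : ZMod p, (θ ^ (3 * j).val + 1) := by
    rw [← prod_mul_distrib, ← prod_mul_distrib]
    exact prod_congr rfl fun j _ => hfac j
  have hre : ∏ j : ZMod p, (θ ^ (3 * j).val + 1) = ∏ j : ZMod p, (θ ^ j.val + 1) :=
    Fintype.prod_equiv (Equiv.mulLeft₀ (3 : ZMod p) h3ne) _ _ (fun j => rfl)
  rw [prod_pow_val_eq_one hp2 hθ', one_mul, hre] at hP
  have hA : ∏ j : ZMod p, (θ ^ j.val + 1) ≠ 0 :=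
    prod_ne_zero_iff.2 fun j _ => pow_val_add_one_ne_zero hp2 hθ j
  exact mul_left_cancel₀ hA (hP.trans (mul_one _).symm)

/-- **Conjugate pairing.** `p` an odd prime, `f : ZMod p → ℂ` with `f (−j) = conj (f j)`: the product of `f` over
`j ≠ 0` is a nonnegative real number. [folklore] -/
theorem prod_erase_zero_nonneg [hp : Fact p.Prime] (hp2 : p ≠ 2) (f : ZMod p → ℂ)
    (hf : ∀ j, f (-j) = starRingEnd ℂ (f j)) :
    ∃ r : ℝ, 0 ≤ r ∧ ∏ j ∈ (univ : Finset (ZMod p)).erase 0, f j = (r : ℂ) := by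
  -- any negation-closed finset avoiding `0`
  suffices h : ∀ S : Finset (ZMod p), (0 ∉ S) → (∀ j ∈ S, -j ∈ S) →
      ∃ r : ℝ, 0 ≤ r ∧ ∏ j ∈ S, f j = (r : ℂ) by
    exact h _ (fun h0 => (mem_erase.1 h0).1 rfl)
      (fun j hj => mem_erase.2 ⟨fun h0 => (mem_erase.1 hj).1 (neg_eq_zero.1 h0), mem_univ _⟩)
  intro S
  induction S using Finset.strongInduction with
  | H S ih =>
    intro h0 hneg
    rcases S.eq_empty_or_nonempty with rfl | ⟨x, hx⟩
    · exact ⟨1, zero_le_one, by simp⟩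
    have hxne : -x ≠ x := fun h => h0 (by rwa [← eq_zero_of_neg_eq_self hp2 h])
    have hsub : ({x, -x} : Finset (ZMod p)) ⊆ S := by
      intro y hy
      rcases mem_insert.1 hy with rfl | hy
      · exact hx
      · rw [mem_singleton.1 hy]; exact hneg x hx
    have hlt : S \ {x, -x} ⊂ S := by
      refine ⟨sdiff_subset, fun hS => ?_⟩
      have := hS hx
      simp at this
    obtain ⟨r, hr, hprod⟩ := ih (S \ {x, -x}) hlt (fun h => h0 (sdiff_subset h)) (by
      intro j hj
      rw [mem_sdiff] at hj ⊢
      refine ⟨hneg j hj.1, fun hm => hj.2 ?_⟩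
      rcases mem_insert.1 hm with h | h
      · rw [mem_insert, mem_singleton]; right; rw [← h, neg_neg]
      · rw [mem_singleton] at h; rw [mem_insert]; left; exact neg_injective h)
    refine ⟨Complex.normSq (f x) * r, mul_nonneg (Complex.normSq_nonneg _) hr, ?_⟩
    rw [← prod_sdiff hsub, hprod, prod_pair hxne.symm, hf x, Complex.mul_conj]
    push_cast; ring

end RootsOfUnity

/-! ## Characters of an exponent-`p` group -/

section ExpChar

variable {B : Type*} [AddCommGroup B] {p : ℕ}

/-- Every character of an exponent-`p` group satisfies `ψ ^ p = 1`. [folklore] -/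
theorem addChar_pow_p (hexp : ∀ b : B, p • b = 0) (ψ : AddChar B ℂ) : ψ ^ p = 1 := by
  ext b
  rw [AddChar.pow_apply, ← AddChar.map_nsmul_eq_pow, hexp, AddChar.map_zero_eq_one, AddChar.one_apply]

/-- Character values of an exponent-`p` group are `p`-th roots of unity. [folklore] -/
theorem addChar_apply_pow_p (hexp : ∀ b : B, p • b = 0) (ψ : AddChar B ℂ) (b : B) : ψ b ^ p = 1 := by
  rw [← AddChar.map_nsmul_eq_pow, hexp, AddChar.map_zero_eq_one]

/-- `ψ ^ (l * j).val = (ψ ^ l.val) ^ j.val`. [folklore] -/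
theorem addChar_pow_val_mul (hexp : ∀ b : B, p • b = 0) (ψ : AddChar B ℂ) (l j : ZMod p) :
    ψ ^ (l * j).val = (ψ ^ l.val) ^ j.val :=
  pow_val_mul (addChar_pow_p hexp ψ) l j

/-- `ψ ^ (-j).val = (ψ ^ j.val)⁻¹`. [folklore] -/
theorem addChar_pow_val_neg [NeZero p] (hexp : ∀ b : B, p • b = 0) (ψ : AddChar B ℂ) (j : ZMod p) :
    ψ ^ (-j).val = (ψ ^ j.val)⁻¹ :=
  eq_inv_of_mul_eq_one_left (pow_val_neg_mul_pow_val (addChar_pow_p hexp ψ) j)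

/-- A non-trivial character of an exponent-`p` group has order exactly `p`: `ψ ^ j ≠ 0` for `j ≢ 0`. [folklore] -/
theorem addChar_pow_ne_zero [hp : Fact p.Prime] (hexp : ∀ b : B, p • b = 0) {ψ : AddChar B ℂ} (hψ : ψ ≠ 0)
    {j : ZMod p} (hj : j ≠ 0) : ψ ^ j.val ≠ 0 := by
  obtain ⟨b, hb⟩ := AddChar.ne_one_iff.1 hψ
  intro h
  have h1 : ψ b ^ j.val = 1 := by
    have := congrArg (fun χ : AddChar B ℂ => χ b) h
    simpa only [AddChar.pow_apply, AddChar.zero_apply] using this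
  have hord : orderOf (ψ b) = p := by
    rcases hp.out.eq_one_or_self_of_dvd _ (orderOf_dvd_of_pow_eq_one (addChar_apply_pow_p hexp ψ b)) with h | h
    · exact absurd (orderOf_eq_one_iff.1 h) hb
    · exact h
  have hdvd : p ∣ j.val := by
    have h := orderOf_dvd_of_pow_eq_one h1
    rwa [hord] at h
  have hlt : j.val < p := ZMod.val_lt j
  have hpos : 0 < j.val := Nat.pos_of_ne_zero fun h0 => hj ((ZMod.val_eq_zero j).1 h0)
  exact absurd (Nat.le_of_dvd hpos hdvd) (not_le.2 hlt)

/-- `conj (ψ b) = ψ⁻¹ b`. [folklore] -/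
theorem conj_addChar_apply [Finite B] (ψ : AddChar B ℂ) (b : B) : starRingEnd ℂ (ψ b) = ψ⁻¹ b := by
  rw [AddChar.inv_apply, AddChar.map_neg_eq_conj]

/-- Character values are algebraic integers. [folklore] -/
theorem isIntegral_addChar_apply [hp : Fact p.Prime] (hexp : ∀ b : B, p • b = 0) (ψ : AddChar B ℂ) (b : B) : IsIntegral ℤ (ψ b) :=
  IsIntegral.of_pow hp.out.pos (by rw [addChar_apply_pow_p hexp]; exact isIntegral_one)

/-! ## Fourier inversion for integer-valued functions -/

/-- **Fourier inversion.** `|B| · E(a) = Σ_ψ Ê(ψ) ψ(−a)` with `Ê(ψ) = Σ_b E(b) ψ(b)`. [folklore] -/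
theorem card_mul_eq_sum_charsum [Fintype B] [DecidableEq B] (E : B → ℤ) (a : B) :
    (Fintype.card B : ℂ) * E a = ∑ ψ : AddChar B ℂ, (∑ b, (E b : ℂ) * ψ b) * ψ (-a) := by
  have e1 : ∀ ψ : AddChar B ℂ, (∑ b, (E b : ℂ) * ψ b) * ψ (-a) = ∑ b, (E b : ℂ) * ψ (b + -a) := by
    intro ψ
    rw [sum_mul]
    exact sum_congr rfl fun b _ => by rw [mul_assoc, AddChar.map_add_eq_mul]
  simp_rw [e1]
  rw [sum_comm]
  simp_rw [← mul_sum, AddChar.sum_apply_eq_ite, add_neg_eq_zero, mul_ite, mul_zero]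
  rw [Finset.sum_ite_eq' univ a, if_pos (mem_univ _), mul_comm]

/-- **Divisibility from constant character sums.** If `Σ_b E(b) ψ(b) = c` for every non-trivial character `ψ`, then
`|B| ∣ Σ_b E(b) − c`. [folklore] -/
theorem card_dvd_of_charsum_const [Fintype B] [DecidableEq B] (E : B → ℤ) (c : ℤ)
    (hE : ∀ ψ : AddChar B ℂ, ψ ≠ 0 → ∑ b, (E b : ℂ) * ψ b = c) :
    (Fintype.card B : ℤ) ∣ (∑ b, E b) - c := by
  by_cases htriv : ∀ a : B, a = 0
  · have : Fintype.card B = 1 := Fintype.card_eq_one_iff.2 ⟨0, htriv⟩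
    rw [this, Nat.cast_one]; exact one_dvd _
  push Not at htriv
  obtain ⟨a, ha⟩ := htriv
  have key := card_mul_eq_sum_charsum E a
  have hsplit : ∀ ψ : AddChar B ℂ, (∑ b, (E b : ℂ) * ψ b) * ψ (-a) =
      (c : ℂ) * ψ (-a) + (if ψ = 0 then ((∑ b, E b : ℤ) : ℂ) - c else 0) := by
    intro ψ
    split_ifs with h0
    · rw [h0]; simp
    · rw [hE ψ h0, add_zero]
  simp_rw [hsplit] at key
  rw [sum_add_distrib, ← mul_sum, AddChar.sum_apply_eq_zero_iff_ne_zero.2 (neg_ne_zero.2 ha), mul_zero, zero_add,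
    Finset.sum_ite_eq' univ (0 : AddChar B ℂ), if_pos (mem_univ _)] at key
  refine ⟨E a, ?_⟩
  exact_mod_cast key.symm

/-- A rational algebraic integer is an integer (`ℤ` is integrally closed). [folklore] -/
theorem exists_int_of_isIntegral_of_eq_rat {z : ℂ} (hz : IsIntegral ℤ z) {q : ℚ} (hq : z = q) :
    ∃ n : ℤ, z = n := by
  have hq' : IsIntegral ℤ q := by
    have hinj : Function.Injective (algebraMap ℚ ℂ) := (algebraMap ℚ ℂ).injective
    rw [← isIntegral_algebraMap_iff (R := ℤ) hinj, eq_ratCast]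
    rw [← hq]; exact hz
  obtain ⟨n, hn⟩ := IsIntegrallyClosed.isIntegral_iff.1 hq'
  refine ⟨n, ?_⟩
  rw [hq, ← hn, eq_intCast, Rat.cast_intCast]

end ExpChar

end Summit.MatrixMultiplication.OmegaCensus.DominoNorm
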